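import Literature.AlgebraicGeometry.Resolution.FrobeniusClosedBases
import Literature.AlgebraicGeometry.Resolution.NormalDegreePDefectlessInseparable
import Literature.AlgebraicGeometry.Resolution.NormalDegreePDefectlessGalois
import Literature.AlgebraicGeometry.Resolution.HenselLift
import Literature.AlgebraicGeometry.Resolution.HenselizedRationalTameExtensions
import Literature.FieldTheory.ArtinSchreier.PrimeDegree
import Mathlib.FieldTheory.SeparableDegree
import HarnessLib

/-!
# The Artin–Schreier normal form: Prop. 4.1 in equal characteristic from Lemma 4.10 and Hensel's Lemma (Kuhlmann 2010, §4.3, Prop. 4.12)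

Topic: `Literature/AlgebraicGeometry/Resolution` (valued function fields). DISCHARGE, down to
the named facts `Kuhlmann2010Lemma410` (`FrobeniusClosedBases.lean`: existence of a subring with
a lifting of a Frobenius-closed basis, Lemma 4.10 with [K5] Thm. 10 and Lemma 2.4) and
`Kuhlmann2010HenselsLemma` (`HenselLift.lean`: a henselian field satisfies Hensel's Lemma), of
the named fact `Kuhlmann2010Prop41RTEqualChar` (`NormalDegreePDefectlessGalois.lean`) = F.-V.
Kuhlmann, *Elimination of ramification I: The generalized stability theorem*, Trans. AMS 362
(2010) 5697–5727 = arXiv:1003.5678, Prop. 4.1 in the residue-transcendental case of equal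
characteristic, along the printed proof of Prop. 4.12 (p. 16 of the arXiv version):

> We can assume that `E|F` is of the form (4.4). By Lemma 4.9 and (4.5), we can also assume that
> `a = ∑ cᵢuᵢ` where `cᵢ ∈ K`, `uᵢ ∈ 𝓑` … such that `vcᵢuᵢ ≤ 0` for all `i ∈ I`. … After a
> replacement procedure similar to the one used in the proof of Proposition 4.5, we can assume
> that no element `uᵢ ≠ 1` is a `p`-th power of another element in `𝓑` … Note that if `uᵢ ≠ 1`,
> then `uᵢ ∈ F ∖ K`, which shows that there exists an integer `ν = ν(uᵢ)` such that
> `uᵢ ∉ F^{p^ν}`. Assume that `vcⱼuⱼ < 0` for some `j ∈ I` with `uⱼ ≠ 1` … Set `d = cⱼ^{-1/p} ∈ K`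
> and `χ := dϑ`. … `χ̄^p = ∑ d̄ᵢūᵢ` … we can infer from part b) of Lemma 4.8 that `χ̄ ∉ F̄`. Thus,
> `[Ē:F̄] ≥ p`. … Assume that all summands `cᵢuᵢ` have value `0`. Then also `ϑ` has value `0`,
> and `ϑ̄^p - ϑ̄ = ∑ c̄ᵢūᵢ`. If the polynomial `X^p - X - ∑ c̄ᵢūᵢ` were reducible, then Hensel's
> Lemma would yield that `[E:F] < p` … Hence `[Ē:F̄] ≥ p`.

Over the algebraically closed `K` of the ambient specialisation the constant term `c·1` lies in
`K = ℘(K)` and is absorbed together with the terms of positive value (`𝓜_F ⊆ ℘(F)`, (4.6)), so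
the third case of Prop. 4.12 (the auxiliary extension `L|K`) does not arise and the first
alternative of Prop. 4.1 — `(E|F,v)` is defectless — always holds.

## Content (everything PROVED; two auxiliary DEFINITIONS `pDepth`, `depthMeasure`)

* `exists_pow_sub_self_eq_of_valuation_lt_one` — (4.6): `𝓜_F ⊆ ℘(F)` when `V ∩ F` satisfies
  Hensel's Lemma.
* `exists_forall_pow_ne` — finite `p`-depth: for `K ≤ F` with `K` algebraically closed and `F`
  separable-algebraic over `K(x)`, every `u ∈ F ∖ K` has `p^ν`-th roots in `F` for only finitely
  many `ν` (exchange lemma, separable degree one minimal polynomials `X^{p^n} - y`).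
* Lemma 4.9 for `IsLiftedFrobeniusClosedBasisRing` and `F` of rank one with `vF = vK`:
  `exists_mem_resid_eq` (`R̄ = F̄`), `exists_mem_valuation_mul_sub_one_lt`,
  `exists_mem_valuation_inv_sub_lt` (geometric series), `exists_mem_valuation_sub_lt` (`R` dense
  in `F`), `exists_mem_add_pow_sub_self` (`F = R + ℘(F)`).
* The reduction: `exists_drop` (Step B), `pDepth`, `depthMeasure`, `pDepth_lt_of_pow_eq`,
  `exists_replace` (Step C), `exists_reduced` (normal form modulo `℘(F)`).
* `valuation_pow_sub_self_of_one_lt`, `valuation_eq_pow_of_one_lt`,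
  `valuation_le_one_of_pow_sub_self` — values of Artin–Schreier generators;
  `isDefectlessExtension_of_finrank_residue_adjoin_eq` — a residue of degree `[E : F]` forces
  defectlessness (fundamental inequality).
* `exists_residue_degree_eq_of_one_lt` (Case 1, Lemma 4.8 (b) and (a)),
  `exists_residue_degree_eq_of_forall_eq_one` (Case 2, Hensel via (4.6) and Lang VI Thm. 6.4 (ii)
  from `Literature.FieldTheory.ArtinSchreier`).
* `isSeparable_of_isUnramifiedOver_henselization` — the fields of the class are separable over
  `K(x)`.
* `Kuhlmann2010Prop41RTEqualChar.of_parts` — the assembly.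

## Sources

* F.-V. Kuhlmann, *Elimination of ramification I: The generalized stability theorem*, Trans.
  Amer. Math. Soc. 362 (2010) 5697–5727 = arXiv:1003.5678: §1 (1), §2.1 (rank one), §2.5,
  §4 ((4.4)–(4.6), Prop. 4.1), §4.2 (Lemmas 4.7–4.10), §4.3 (Prop. 4.12 and its proof; the
  replacement procedure of Prop. 4.5).
* S. Lang, *Algebra*, GTM 211, VI §6 Thm. 6.4 (through `Literature.FieldTheory.ArtinSchreier`).
-/

noncomputable section

open IsLocalRing

namespace Literature.AlgebraicGeometry.Resolution

universe u

/-! ### (4.6): `𝓜_F ⊆ ℘(F)` by Hensel's Lemma -/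

section HenselConsequences

variable {Ω : Type u} [Field Ω] (V : ValuationSubring Ω)

open Polynomial in
/-- **Kuhlmann 2010, (4.6): `𝓜_F ⊆ ℘(F)`** ("by Hensel's Lemma, `X^p - X - a` has a root in the
henselian field `F` whenever `va > 0`"): if the valuation ring `V ∩ F` of `F ≤ Ω` satisfies
Hensel's Lemma, then every `a ∈ F` of value `< 1` is `d^p - d` for some `d ∈ F` of value `< 1`
(the residue polynomial `X^p - X` has the simple root `0`). PROVED. [cite: Kuhlmann2010, Section 4, (4.6)] -/
theorem exists_pow_sub_self_eq_of_valuation_lt_one (F : Subfield Ω)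
    [hF : HenselianLocalRing (V.comap (algebraMap F Ω))] {p : ℕ} (hp : 2 ≤ p) {a : Ω}
    (haF : a ∈ F) (hva : V.valuation a < 1) :
    ∃ d ∈ F, V.valuation d < 1 ∧ d ^ p - d = a := by
  set O : ValuationSubring F := V.comap (algebraMap F Ω) with hO
  have haV : a ∈ V := (V.valuation_le_one_iff a).mp hva.le
  set a₀ : O := ⟨⟨a, haF⟩, haV⟩ with ha₀
  set f : Polynomial O := X ^ p - X - C a₀ with hf
  have hmonic : f.Monic := by
    rw [hf, sub_sub]
    refine monic_X_pow_sub ?_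
    calc (X + C a₀ : Polynomial O).degree ≤ 1 := by
          refine (degree_add_le _ _).trans (max_le degree_X_le (degree_C_le.trans zero_le_one))
      _ < p := by exact_mod_cast hp
  -- `f(0) = -a₀ ∈ 𝔪` and `f'(0) = -1` is a unit
  have hmem : ∀ c : O, c ∈ maximalIdeal O ↔ V.valuation ((c : F) : Ω) < 1 := fun c => by
    rw [← residueHom_eq_zero_iff V F c, residueHom_apply, residue_eq_zero_iff,
      ValuationSubring.valuation_lt_one_iff]
  have h1 : f.eval 0 ∈ maximalIdeal O := by
    have : f.eval 0 = -a₀ := by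
      rw [hf, eval_sub, eval_sub, eval_pow, eval_X, eval_C, zero_pow (by omega), zero_sub, neg_zero,
        zero_sub]
    rw [this, neg_mem_iff, hmem]
    exact hva
  have h2 : IsUnit (f.derivative.eval 0) := by
    have : f.derivative.eval 0 = -1 := by
      rw [hf, derivative_sub, derivative_sub, derivative_X_pow, derivative_X, derivative_C,
        eval_sub, eval_sub, eval_mul, eval_C, eval_pow, eval_X, zero_pow (by omega), mul_zero,
        eval_one, eval_zero, zero_sub, sub_zero]
    rw [this]
    exact isUnit_one.neg
  obtain ⟨y, hy, hy0⟩ := HenselianLocalRing.is_henselian f hmonic 0 h1 h2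
  refine ⟨((y : F) : Ω), (y : F).2, ?_, ?_⟩
  · rw [sub_zero] at hy0
    exact (hmem y).mp hy0
  · have h3 : (y : O) ^ p - y - a₀ = 0 := by
      have := hy.eq_zero
      rwa [hf, eval_sub, eval_sub, eval_pow, eval_X, eval_C] at this
    have h4 : ((((y : O) ^ p - y - a₀ : O) : F) : Ω) = ((0 : O) : F) := by rw [h3]
    have h5 : ((((y : O) ^ p - y - a₀ : O) : F) : Ω) = ((y : F) : Ω) ^ p - ((y : F) : Ω) - a := rfl
    rw [h5] at h4
    exact sub_eq_zero.mp h4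

end HenselConsequences

/-! ### Finite `p`-depth of the elements of `F ∖ K` -/

section FinitePDepth

variable {Ω : Type u} [Field Ω]

open Polynomial in
/-- **Finite `p`-depth** (Kuhlmann 2010, proof of Prop. 4.12: "Note that if `uᵢ ≠ 1`, then
`uᵢ ∈ F ∖ K`, which shows that there exists an integer `ν = ν(uᵢ)` such that `uᵢ ∉ F^{p^ν}`"),
for `K ≤ F ≤ Ω` with `K` algebraically closed, `char Ω = p`, and `F` separable-algebraic over
`K(x)` for some `x ∈ F`: every `u ∈ F ∖ K` has a `p^ν`-th root in `F` for only finitely many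
`ν`. Proof: `u` is transcendental over `K`, `F` is algebraic over `K(u)` (exchange),
and a `p^ν`-th root `w ∈ F` of `u` lies in the finite extension `K(u)(x)` (it is separable over
it and purely inseparable over it); its minimal polynomial over `K(u)` is `X^{p^n} - y` with
`n ≥ ν` (`u` is no `p`-th power in `K(u)`), so `p^ν ≤ [K(u)(x) : K(u)]`. PROVED.
[cite: Kuhlmann2010, Prop. 4.12 (proof)] -/
theorem exists_forall_pow_ne (p : ℕ) [hp : Fact p.Prime] [CharP Ω p] {K F : Subfield Ω}
    (hK : IsAlgClosed K) (hKF : K ≤ F) {x : Ω} (hxF : x ∈ F)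
    (hsep' : ∀ z ∈ F, IsSeparable (IntermediateField.adjoin K ({x} : Set Ω)).toSubfield z)
    {u : Ω} (huF : u ∈ F) (huK : u ∉ K) : ∃ ν : ℕ, ∀ w ∈ F, w ^ p ^ ν ≠ u := by
  haveI : ExpChar Ω p := ExpChar.prime hp.out
  -- separability over `K(x)` as an intermediate field
  have hsep : ∀ z ∈ F, IsSeparable (IntermediateField.adjoin K ({x} : Set Ω)) z := fun z hz =>
    isSeparable_of_ringHom_comp_eq
      (F₁ := (IntermediateField.adjoin K ({x} : Set Ω)).toSubfield)
      (F₂ := IntermediateField.adjoin K ({x} : Set Ω))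
      { toFun := fun c => ⟨c.1, c.2⟩
        map_one' := rfl
        map_mul' := fun _ _ => rfl
        map_zero' := rfl
        map_add' := fun _ _ => rfl } (RingHom.ext fun _ => rfl) (hsep' z hz)
  -- `u` is transcendental over `K`, and `F` is algebraic over `K(u)` (exchange)
  have hu : Transcendental K u := fun h => huK (mem_of_isAlgebraic_of_isAlgClosed hK h)
  have halgx : ∀ z ∈ F, IsAlgebraic (IntermediateField.adjoin K ({x} : Set Ω)) z :=
    fun z hz => (hsep z hz).isIntegral.isAlgebraic
  have halgu : ∀ z ∈ F, IsAlgebraic (IntermediateField.adjoin K ({u} : Set Ω)) z :=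
    isAlgebraic_adjoin_singleton_of_transcendental hKF hxF huF hu halgx
  set Ku : IntermediateField K Ω := IntermediateField.adjoin K ({u} : Set Ω) with hKu
  haveI : ExpChar Ku p := (algebraMap Ku Ω).expChar (algebraMap Ku Ω).injective p
  have huKu : u ∈ Ku := IntermediateField.mem_adjoin_simple_self K u
  -- the finite extension `M = K(u)(x)` of `K(u)`
  have hxint : IsIntegral Ku x := (halgu x hxF).isIntegral
  set M : IntermediateField Ku Ω := IntermediateField.adjoin Ku ({x} : Set Ω) with hM
  haveI : FiniteDimensional Ku M := IntermediateField.adjoin.finiteDimensional hxint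
  haveI : ExpChar M p := (algebraMap M Ω).expChar (algebraMap M Ω).injective p
  set D := Module.finrank Ku M with hD
  refine ⟨D, fun w hwF hwu => ?_⟩
  -- `K(x) ≤ M`
  have hle : IntermediateField.adjoin K ({x} : Set Ω) ≤ IntermediateField.restrictScalars K M := by
    rw [IntermediateField.adjoin_le_iff, Set.singleton_subset_iff]
    exact IntermediateField.mem_adjoin_simple_self Ku x
  -- `w ∈ M`: separable over `M` and `w^{p^D} = u ∈ M`
  have hwM : w ∈ M := by
    have hsepM : IsSeparable M w := by
      have h1 : IsSeparable (IntermediateField.restrictScalars K M) w :=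
        isSeparable_of_ringHom_comp_eq (IntermediateField.inclusion hle).toRingHom
          (RingHom.ext fun _ => rfl) (hsep w hwF)
      exact h1
    have huM : u ∈ M := M.algebraMap_mem ⟨u, huKu⟩
    have h1 : w ^ p ^ D ∈ Set.range (algebraMap M Ω) := by
      rw [hwu]
      exact ⟨⟨u, huM⟩, rfl⟩
    obtain ⟨w', hw'⟩ := mem_range_of_isSeparable_of_pow_mem p hsepM D h1
    rw [← hw']
    exact w'.2
  -- the minimal polynomial of `w` over `K(u)` is `X^{p^n} - y`, with `w^{p^n} = y`
  have hwint : IsIntegral Ku w := (halgu w hwF).isIntegral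
  have hpowmem : ∃ n : ℕ, w ^ p ^ n ∈ (algebraMap Ku Ω).range := ⟨D, ⟨⟨u, huKu⟩, hwu.symm⟩⟩
  obtain ⟨n, y, hmin⟩ := (minpoly.natSepDegree_eq_one_iff_eq_X_pow_sub_C p).mp
    ((minpoly.natSepDegree_eq_one_iff_pow_mem p).mpr hpowmem)
  have hwn : w ^ p ^ n = (y : Ω) := by
    have := minpoly.aeval Ku w
    rw [hmin, map_sub, aeval_C, map_pow, aeval_X, sub_eq_zero] at this
    exact this
  -- `n ≥ D`: otherwise `u` would be a `p`-th power in `K(u)`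
  have hnD : D ≤ n := by
    by_contra hlt
    push Not at hlt
    obtain ⟨e, he⟩ := Nat.exists_eq_add_of_lt hlt
    have h1 : u = ((y : Ω) ^ p ^ e) ^ p := by
      rw [← hwu, he, ← hwn, ← pow_mul, ← pow_mul, ← pow_succ, ← pow_add, Nat.add_assoc]
    have hyK : (y : Ω) ^ p ^ e ∈ IntermediateField.adjoin K ({u} : Set Ω) := pow_mem y.2 _
    exact pow_ne_of_transcendental_of_mem_adjoin hu hp.out.ne_one hyK h1.symm
  -- degrees: `p^n = [K(u)(w) : K(u)] ≤ [M : K(u)] = D < p^D ≤ p^n`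
  have hdeg : Module.finrank Ku (IntermediateField.adjoin Ku ({w} : Set Ω)) = p ^ n := by
    rw [IntermediateField.adjoin.finrank hwint, hmin, natDegree_X_pow_sub_C]
  have hle2 : IntermediateField.adjoin Ku ({w} : Set Ω) ≤ M :=
    IntermediateField.adjoin_simple_le_iff.mpr hwM
  have h1 : p ^ n ≤ D := by
    rw [← hdeg, hD]
    exact IntermediateField.finrank_le_of_le_right hle2
  have h2 : D < p ^ D := Nat.lt_pow_self hp.out.one_lt
  have h3 : p ^ D ≤ p ^ n := Nat.pow_le_pow_right hp.out.pos hnD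
  omega

end FinitePDepth

/-! ### Lemma 4.9: `R` is dense in `F`, and `F = R + ℘(F)` -/

section Density

variable {Ω : Type u} [Field Ω] {V : ValuationSubring Ω} {p : ℕ} {K F : Subfield Ω}
  {R : Subring Ω} {B : Set Ω}

/-- **Rank one: powers of an element of value `< 1` become arbitrarily small** (the value group
of `F` is archimedean, `IsRankOneValued`). [cite: Kuhlmann2010, Section 2.1] -/
theorem IsRankOneValued.exists_pow_lt (hr1 : IsRankOneValued V F) {t : Ω} (htF : t ∈ F) (ht0 : t ≠ 0)
    (ht : V.valuation t < 1) {η : Ω} (hηF : η ∈ F) (hη0 : η ≠ 0) :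
    ∃ n : ℕ, V.valuation t ^ (n + 1) < V.valuation η := by
  have hvt0 : V.valuation t ≠ 0 := (Valuation.ne_zero_iff _).mpr ht0
  have hvη0 : V.valuation η ≠ 0 := (Valuation.ne_zero_iff _).mpr hη0
  have h1 : 1 < V.valuation t⁻¹ := by
    rw [map_inv₀]
    exact one_lt_inv_iff₀.mpr ⟨(Valuation.pos_iff _).mpr ht0, ht⟩
  obtain ⟨n, hn⟩ := hr1.2 t⁻¹ (inv_mem htF) η⁻¹ (inv_mem hηF) h1
  refine ⟨n, ?_⟩
  rw [map_inv₀, map_inv₀, inv_pow, inv_le_inv₀ ((Valuation.pos_iff _).mpr hη0)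
    (pow_pos ((Valuation.pos_iff _).mpr ht0) n)] at hn
  calc V.valuation t ^ (n + 1) = V.valuation t ^ n * V.valuation t := pow_succ _ _
    _ < V.valuation t ^ n * 1 := by
        exact mul_lt_mul_of_pos_left ht (pow_pos ((Valuation.pos_iff _).mpr ht0) n)
    _ = V.valuation t ^ n := mul_one _
    _ ≤ V.valuation η := hn

namespace IsLiftedFrobeniusClosedBasisRing

variable (h : IsLiftedFrobeniusClosedBasisRing V p K F R B)
include h

/-- **`R̄ = F̄`**: every element of `F̄` is the residue of an element of `R ∩ V` (from (LFC2):
the residues of `𝓑` span `F̄` over `K̄`, and the coefficients lift to `K`). PROVED.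
[cite: Kuhlmann2010, Lemma 4.9 (proof)] -/
theorem exists_mem_resid_eq {r : ResidueField V} (hr : r ∈ residueSubfield F V) :
    ∃ a ∈ R, a ∈ V ∧ resid V a = r := by
  classical
  obtain ⟨g, hg⟩ := Finsupp.mem_span_range_iff_exists_finsupp.mp (h.resid_span r hr)
  have hlift : ∀ u : B, ∃ c : Ω, c ∈ K ∧ c ∈ V ∧ resid V c = (g u : ResidueField V) := fun u => by
    obtain ⟨c, hcK, hcV, hc⟩ := exists_resid_eq_of_mem_residueSubfield V (g u).2
    exact ⟨c, hcK, hcV, hc⟩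
  choose c hcK hcV hc using hlift
  refine ⟨∑ u ∈ g.support, c u * (u : Ω), ?_, ?_, ?_⟩
  · exact R.sum_mem fun u _ => R.mul_mem (h.subfield_le (hcK u)) (h.subset u.2)
  · exact sum_mem fun u _ => mul_mem (hcV u) (h.mem_valuationSubring u.2)
  · rw [resid_sum V _ _ fun u _ => mul_mem (hcV u) (h.mem_valuationSubring u.2), ← hg,
      Finsupp.sum]
    refine Finset.sum_congr rfl fun u _ => ?_
    rw [resid_mul V (hcV u) (h.mem_valuationSubring u.2), hc u, Algebra.smul_def]
    rfl

omit h in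
/-- For `s ∈ F^×` there is `c ∈ K` with `v(s·c) = 0`, when `vF = vK`. [folklore] -/
theorem exists_mem_valuation_mul_eq_one (hv : valueSubgroup F V = valueSubgroup K V) {s : Ω}
    (hsF : s ∈ F) (hs0 : s ≠ 0) : ∃ c ∈ K, V.valuation (s * c) = 1 := by
  have hvs0 : V.valuation s ≠ 0 := (Valuation.ne_zero_iff _).mpr hs0
  have hmem : Units.mk0 _ hvs0 ∈ valueSubgroup F V :=
    (mem_valueSubgroup_iff F V _).mpr ⟨⟨s, hsF⟩, fun h0 => hs0 (congrArg Subtype.val h0), rfl⟩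
  rw [hv] at hmem
  obtain ⟨c, hc0, hc⟩ := (mem_valueSubgroup_iff K V _).mp hmem
  rw [Units.val_mk0] at hc
  have hc0' : (c : Ω) ≠ 0 := fun h0 => hc0 (Subtype.ext h0)
  refine ⟨(c : Ω)⁻¹, inv_mem c.2, ?_⟩
  rw [map_mul, map_inv₀, hc]
  exact mul_inv_cancel₀ ((Valuation.ne_zero_iff _).mpr hc0')

/-- **An approximate inverse in `R`**: for `0 ≠ s ∈ R` there is `s' ∈ R` with `v(ss' - 1) > 0`
(source: "there is some `s₁ ∈ R` such that `vrs₁ = 0` and that the residue of the element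
`rs₁ ∈ R` has an inverse in `R̄`, say `s̄₂` … Then the element `s = s₁s₂` has the desired
property"). PROVED. [cite: Kuhlmann2010, Lemma 4.9 (proof)] -/
theorem exists_mem_valuation_mul_sub_one_lt (hv : valueSubgroup F V = valueSubgroup K V) {s : Ω}
    (hsR : s ∈ R) (hs0 : s ≠ 0) : ∃ s' ∈ R, V.valuation (s * s' - 1) < 1 := by
  have hsF : s ∈ F := h.le_subfield hsR
  obtain ⟨c, hcK, hc⟩ := exists_mem_valuation_mul_eq_one hv hsF hs0
  have hscV : s * c ∈ V := (V.valuation_le_one_iff _).mp hc.le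
  have hres0 : resid V (s * c) ≠ 0 := (resid_ne_zero_iff V hscV).mpr hc
  have hresF : (resid V (s * c))⁻¹ ∈ residueSubfield F V :=
    inv_mem (resid_mem_residueSubfield V (F.mul_mem hsF (h.subfield_le_subfield hcK)))
  obtain ⟨s₂, hs₂R, hs₂V, hs₂⟩ := h.exists_mem_resid_eq hresF
  refine ⟨c * s₂, R.mul_mem (h.subfield_le hcK) hs₂R, ?_⟩
  have hmem : s * (c * s₂) ∈ V := by
    rw [← mul_assoc]
    exact mul_mem hscV hs₂V
  rw [← resid_eq_resid_iff V hmem V.one_mem, resid_one, ← mul_assoc, resid_mul V hscV hs₂V, hs₂]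
  exact mul_inv_cancel₀ hres0

/-- **`1/s` is approximated by elements of `R`** for `0 ≠ s ∈ R` (geometric series:
"`1/r = s/(1 - (1-rs))` … proceed as in the proof of Lemma 4.4", using rank one). PROVED.
[cite: Kuhlmann2010, Lemma 4.9 (proof)] -/
theorem exists_mem_valuation_inv_sub_lt (hr1 : IsRankOneValued V F)
    (hv : valueSubgroup F V = valueSubgroup K V) {s : Ω} (hsR : s ∈ R) (hs0 : s ≠ 0)
    {η : Ω} (hηF : η ∈ F) (hη0 : η ≠ 0) : ∃ r ∈ R, V.valuation (s⁻¹ - r) < V.valuation η := by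
  have hsF : s ∈ F := h.le_subfield hsR
  obtain ⟨s', hs'R, hs'⟩ := h.exists_mem_valuation_mul_sub_one_lt hv hsR hs0
  set t : Ω := 1 - s * s' with ht
  have htR : t ∈ R := R.sub_mem R.one_mem (R.mul_mem hsR hs'R)
  have hvt : V.valuation t < 1 := by
    rw [ht, ← neg_sub, Valuation.map_neg]
    exact hs'
  -- the partial sums `r_n = s' ∑_{i ≤ n} tⁱ ∈ R` satisfy `1/s - r_n = t^{n+1}/s`
  have hkey : ∀ n : ℕ, s⁻¹ - s' * ∑ i ∈ Finset.range (n + 1), t ^ i = t ^ (n + 1) * s⁻¹ := by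
    intro n
    have hgeom : (∑ i ∈ Finset.range (n + 1), t ^ i) * (1 - t) = 1 - t ^ (n + 1) :=
      geom_sum_mul_neg t (n + 1)
    have h1t : 1 - t = s * s' := by rw [ht]; ring
    rw [h1t] at hgeom
    have h2 : s' * ∑ i ∈ Finset.range (n + 1), t ^ i = (1 - t ^ (n + 1)) / s := by
      rw [eq_div_iff hs0, ← hgeom]
      ring
    rw [h2]
    field_simp
    ring
  by_cases ht0 : t = 0
  · refine ⟨s' * ∑ i ∈ Finset.range 1, t ^ i, R.mul_mem hs'R (R.sum_mem fun i _ => R.pow_mem htR i), ?_⟩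
    rw [hkey 0, ht0, zero_pow (Nat.succ_ne_zero 0), zero_mul, map_zero]
    exact (Valuation.pos_iff _).mpr hη0
  · obtain ⟨n, hn⟩ := hr1.exists_pow_lt (h.le_subfield htR) ht0 hvt (F.mul_mem hηF hsF)
      (mul_ne_zero hη0 hs0)
    refine ⟨s' * ∑ i ∈ Finset.range (n + 1), t ^ i,
      R.mul_mem hs'R (R.sum_mem fun i _ => R.pow_mem htR i), ?_⟩
    rw [hkey n, map_mul, map_inv₀]
    rw [map_mul, ← map_pow] at hn
    have hvs : 0 < V.valuation s := (Valuation.pos_iff _).mpr hs0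
    calc V.valuation (t ^ (n + 1)) * (V.valuation s)⁻¹
        < V.valuation η * V.valuation s * (V.valuation s)⁻¹ :=
          mul_lt_mul_of_pos_right hn (inv_pos.mpr hvs)
      _ = V.valuation η := by rw [mul_assoc, mul_inv_cancel₀ hvs.ne', mul_one]

/-- **`R` is dense in Quot(`R`)** (the elements `y/z` of the subfield generated by `R`). PROVED.
[cite: Kuhlmann2010, Lemma 4.9 (proof)] -/
theorem exists_mem_valuation_sub_lt_of_mem_closure (hr1 : IsRankOneValued V F)
    (hv : valueSubgroup F V = valueSubgroup K V) {q : Ω} (hq : q ∈ Subfield.closure (R : Set Ω))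
    {η : Ω} (hηF : η ∈ F) (hη0 : η ≠ 0) : ∃ r ∈ R, V.valuation (q - r) < V.valuation η := by
  obtain ⟨y, hy, z, hz, rfl⟩ := Subfield.mem_closure_iff.mp hq
  rw [Subring.closure_eq] at hy hz
  have hvη : 0 < V.valuation η := (Valuation.pos_iff _).mpr hη0
  by_cases hz0 : z = 0
  · refine ⟨0, R.zero_mem, ?_⟩
    rw [hz0, div_zero, sub_zero, map_zero]
    exact hvη
  by_cases hy0 : y = 0
  · refine ⟨0, R.zero_mem, ?_⟩
    rw [hy0, zero_div, sub_zero, map_zero]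
    exact hvη
  · have hyF : y ∈ F := h.le_subfield hy
    obtain ⟨r', hr'R, hr'⟩ := h.exists_mem_valuation_inv_sub_lt hr1 hv hz hz0
      (F.div_mem hηF hyF) (div_ne_zero hη0 hy0)
    refine ⟨y * r', R.mul_mem hy hr'R, ?_⟩
    have h1 : y / z - y * r' = y * (z⁻¹ - r') := by ring
    rw [h1, map_mul]
    rw [map_div₀] at hr'
    have hvy : 0 < V.valuation y := (Valuation.pos_iff _).mpr hy0
    calc V.valuation y * V.valuation (z⁻¹ - r') < V.valuation y * (V.valuation η / V.valuation y) :=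
          mul_lt_mul_of_pos_left hr' hvy
      _ = V.valuation η := mul_div_cancel₀ _ hvy.ne'

/-- **Kuhlmann 2010, Lemma 4.9 (first assertion): `R` is dense in `F`** ("Let `F` be henselian
of rank 1. Then the properties (LFC1) and (LFC2) imply that `R` is dense in `F`"), for `F` of
rank one (`IsRankOneValued`) with `vF = vK` (the residue-transcendental case (4.3): "In this
case, `vF = vK`"). PROVED. [cite: Kuhlmann2010, Lemma 4.9] -/
theorem exists_mem_valuation_sub_lt (hr1 : IsRankOneValued V F)
    (hv : valueSubgroup F V = valueSubgroup K V) {a : Ω} (haF : a ∈ F) {ε : Ω} (hεF : ε ∈ F)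
    (hε0 : ε ≠ 0) : ∃ r ∈ R, V.valuation (a - r) < V.valuation ε := by
  obtain ⟨q, hq, hvq⟩ := h.dense a haF ε hεF hε0
  obtain ⟨r, hrR, hvr⟩ := h.exists_mem_valuation_sub_lt_of_mem_closure hr1 hv hq hεF hε0
  refine ⟨r, hrR, ?_⟩
  have : a - r = (a - q) + (q - r) := by ring
  rw [this]
  exact Valuation.map_add_lt _ hvq hvr

/-- **Kuhlmann 2010, Lemma 4.9 (second assertion): `F = R + ℘(F)`** ("If `char K = p`, then
`F = R + ℘(F)`": by density `a = r + m` with `vm > 0`, and `𝓜_F ⊆ ℘(F)` by Hensel's Lemma,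
(4.6)), for `F` of rank one with `vF = vK` whose valuation ring `V ∩ F` satisfies Hensel's Lemma.
PROVED. [cite: Kuhlmann2010, Lemma 4.9 and (4.6)] -/
theorem exists_mem_add_pow_sub_self [HenselianLocalRing (V.comap (algebraMap F Ω))] (hp : 2 ≤ p)
    (hr1 : IsRankOneValued V F) (hv : valueSubgroup F V = valueSubgroup K V) {a : Ω} (haF : a ∈ F) :
    ∃ r ∈ R, ∃ d ∈ F, V.valuation d < 1 ∧ a = r + (d ^ p - d) := by
  obtain ⟨r, hrR, hvr⟩ := h.exists_mem_valuation_sub_lt hr1 hv haF F.one_mem one_ne_zero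
  rw [map_one] at hvr
  obtain ⟨d, hdF, hvd, hd⟩ := exists_pow_sub_self_eq_of_valuation_lt_one V F hp
    (F.sub_mem haF (h.le_subfield hrR)) hvr
  exact ⟨r, hrR, d, hdF, hvd, by rw [hd]; ring⟩

end IsLiftedFrobeniusClosedBasisRing

end Density

/-! ### The Artin–Schreier normal form (Prop. 4.12) over an algebraically closed `K` -/

section Prop412

variable {Ω : Type u} [Field Ω] {V : ValuationSubring Ω} {p : ℕ}
  {K F : Subfield Ω} {R : Subring Ω} {B : Set Ω}

/-- **Additivity of `℘(X) = X^p - X` on sums.** [folklore] -/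
theorem pow_sub_self_add [hp : Fact p.Prime] [CharP Ω p] (d₁ d₂ : Ω) :
    (d₁ + d₂) ^ p - (d₁ + d₂) = (d₁ ^ p - d₁) + (d₂ ^ p - d₂) := by
  rw [add_pow_char]
  ring

/-- Over an algebraically closed `K ≤ Ω`, `K = ℘(K)`: every `c ∈ K` is `d^p - d` with `d ∈ K`.
[folklore] -/
theorem exists_pow_sub_self_eq_of_isAlgClosed [hp : Fact p.Prime] (hK : IsAlgClosed K) {c : Ω}
    (hc : c ∈ K) :
    ∃ d ∈ K, d ^ p - d = c := by
  haveI := hK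
  open Polynomial in
  have hdeg : (X ^ p - X - C (⟨c, hc⟩ : K) : Polynomial K).degree ≠ 0 := by
    rw [sub_sub, degree_sub_eq_left_of_degree_lt] <;> rw [degree_X_pow]
    · exact_mod_cast hp.out.ne_zero
    · refine (degree_add_le _ _).trans_lt (max_lt ?_ ?_)
      · rw [degree_X]; exact_mod_cast hp.out.one_lt
      · exact degree_C_le.trans_lt (by exact_mod_cast hp.out.pos)
  obtain ⟨d, hd⟩ := IsAlgClosed.exists_root _ hdeg
  refine ⟨(d : Ω), d.2, ?_⟩
  have h1 : (d : K) ^ p - d - ⟨c, hc⟩ = 0 := by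
    have := hd
    rwa [Polynomial.IsRoot.def, Polynomial.eval_sub, Polynomial.eval_sub, Polynomial.eval_pow,
      Polynomial.eval_X, Polynomial.eval_C] at this
  have h2 := congrArg (fun z : K => (z : Ω)) h1
  simp only [ZeroMemClass.coe_zero] at h2
  have h3 : (((d : K) ^ p - d - ⟨c, hc⟩ : K) : Ω) = (d : Ω) ^ p - d - c := rfl
  rw [h3] at h2
  exact sub_eq_zero.mp h2

/-- Over an algebraically closed `K ≤ Ω`, every `c ∈ K` has a `p`-th root in `K`. [folklore] -/
theorem exists_pow_eq_of_isAlgClosed [hp : Fact p.Prime] (hK : IsAlgClosed K) {c : Ω} (hc : c ∈ K) :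
    ∃ d ∈ K, d ^ p = c := by
  haveI := hK
  obtain ⟨d, hd⟩ := IsAlgClosed.exists_pow_nat_eq (⟨c, hc⟩ : K) hp.out.pos
  exact ⟨(d : Ω), d.2, by have := congrArg (fun z : K => (z : Ω)) hd; simpa using this⟩

namespace IsLiftedFrobeniusClosedBasisRing

variable (h : IsLiftedFrobeniusClosedBasisRing V p K F R B)
include h

/-- **An element `u ≠ 1` of `𝓑` does not lie in `K`** (its residue and `1̄` are `K̄`-linearly
independent). [cite: Kuhlmann2010, Prop. 4.12 (proof: "if `uᵢ ≠ 1`, then `uᵢ ∈ F ∖ K`")] -/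
theorem not_mem_subfield {u : Ω} (hu : u ∈ B) (hu1 : u ≠ 1) : u ∉ K := by
  intro huK
  have huV : u ∈ V := h.mem_valuationSubring hu
  -- the residue of `u` is a `K̄`-multiple of the residue of `1`
  have hr : resid V u = (⟨resid V u, resid_mem_residueSubfield V huK⟩ : residueSubfield K V) •
      resid V ((⟨1, h.one_mem⟩ : B) : Ω) := by
    rw [Algebra.smul_def, resid_one, mul_one]
    rfl
  -- the relation `ū - c·1̄ = 0` contradicts linear independence
  classical
  set i₁ : B := ⟨1, h.one_mem⟩ with hi₁
  set i₂ : B := ⟨u, hu⟩ with hi₂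
  have hne : i₁ ≠ i₂ := fun h12 => hu1 (congrArg Subtype.val h12).symm
  set c : residueSubfield K V := ⟨resid V u, resid_mem_residueSubfield V huK⟩ with hc
  set l : B →₀ residueSubfield K V := Finsupp.single i₂ 1 - Finsupp.single i₁ c with hl
  have hlc : Finsupp.linearCombination (residueSubfield K V) (fun w : B => resid V (w : Ω)) l = 0 := by
    rw [hl, map_sub, Finsupp.linearCombination_single, Finsupp.linearCombination_single, one_smul,
      sub_eq_zero]
    exact hr
  have hl0 : l = 0 := linearIndependent_iff.mp h.resid_linearIndependent l hlc
  have h1 : l i₂ = 1 := by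
    rw [hl, Finsupp.sub_apply, Finsupp.single_eq_same, Finsupp.single_eq_of_ne' hne, sub_zero]
  rw [hl0, Finsupp.zero_apply] at h1
  exact zero_ne_one h1

omit h in
/-- The coefficient family of a filtered finsupp agrees with the original on its support.
[folklore] -/
theorem filter_apply_of_mem {P : B → Prop} [DecidablePred P] (f : B →₀ K) {u : B}
    (hu : u ∈ (f.filter P).support) : f.filter P u = f u := by
  rw [Finsupp.support_filter, Finset.mem_filter] at hu
  rw [Finsupp.filter_apply, if_pos hu.2]

omit h in
/-- A finsupp supported in `{i}` is `single i (f i)`. [folklore] -/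
theorem eq_single_of_support_subset {ι M : Type*} [Zero M] (f : ι →₀ M) (i : ι)
    (hf : ∀ j ∈ f.support, j = i) : f = Finsupp.single i (f i) :=
  (Finsupp.eq_single_iff).mpr ⟨fun j hj => Finset.mem_singleton.mpr (hf j hj), rfl⟩

/-- **Step B of the reduction (drop the constant term and the terms of positive value)**: for a
`K`-linear combination `∑ cᵤ u` of `𝓑`, the terms with `u = 1` (in `K = ℘(K)`, `K` algebraically
closed) and the terms with `vcᵤ > 0` (in `𝓜_F ⊆ ℘(F)`, (4.6)) lie in `℘(F)` (Kuhlmann 2010,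
proof of Prop. 4.12 via (4.5): "we can replace `a` by any other element of `a + ℘(F)` without
changing the Artin–Schreier extension"). PROVED. [cite: Kuhlmann2010, Prop. 4.12 (proof)] -/
theorem exists_drop [hp : Fact p.Prime] [CharP Ω p] [HenselianLocalRing (V.comap (algebraMap F Ω))]
    (hK : IsAlgClosed K) (f : B →₀ K) :
    ∃ (f₁ : B →₀ K) (d : Ω), d ∈ F ∧ f₁.support ⊆ f.support ∧
      (∀ u ∈ f₁.support, (u : Ω) ≠ 1 ∧ 1 ≤ V.valuation (f₁ u : Ω)) ∧
      Finsupp.linearCombination K ((↑) : B → Ω) f -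
        Finsupp.linearCombination K ((↑) : B → Ω) f₁ = d ^ p - d := by
  classical
  set P : B → Prop := fun u => (u : Ω) ≠ 1 ∧ 1 ≤ V.valuation (f u : Ω) with hP
  set f₁ := f.filter P with hf₁
  set fr := f.filter (fun u => ¬ P u) with hfr
  set fc := fr.filter (fun u : B => (u : Ω) = 1) with hfc
  set fs := fr.filter (fun u : B => ¬ (u : Ω) = 1) with hfs
  have hsplit : f = f₁ + fr := (Finsupp.filter_add_filter_not f P).symm
  have hsplit2 : fr = fc + fs := (Finsupp.filter_add_filter_not fr (fun u : B => (u : Ω) = 1)).symm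
  -- the constant term
  set i₁ : B := ⟨1, h.one_mem⟩ with hi₁
  have hfc_single : fc = Finsupp.single i₁ (fc i₁) := by
    refine eq_single_of_support_subset fc i₁ fun j hj => ?_
    rw [hfc, Finsupp.support_filter, Finset.mem_filter] at hj
    exact Subtype.ext hj.2
  have hlc_c : Finsupp.linearCombination K ((↑) : B → Ω) fc = (fc i₁ : Ω) := by
    rw [hfc_single, Finsupp.linearCombination_single, Finsupp.single_eq_same, Algebra.smul_def]
    change (fc i₁ : Ω) * 1 = _
    rw [mul_one]
  obtain ⟨dc, hdcK, hdc⟩ := exists_pow_sub_self_eq_of_isAlgClosed (p := p) hK (fc i₁).2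
  -- the terms of positive value
  have hfs_val : ∀ u ∈ fs.support, V.valuation (fs u : Ω) < 1 := by
    intro u hu
    have hu' := hu
    rw [hfs, Finsupp.support_filter, Finset.mem_filter, hfr, Finsupp.support_filter,
      Finset.mem_filter] at hu'
    obtain ⟨⟨-, hnP⟩, hu1⟩ := hu'
    have hval : fs u = f u := by
      rw [hfs, Finsupp.filter_apply, if_pos hu1, hfr, Finsupp.filter_apply, if_pos hnP]
    rw [hval]
    by_contra hge
    exact hnP ⟨hu1, not_lt.mp hge⟩
  have hlc_s : V.valuation (Finsupp.linearCombination K ((↑) : B → Ω) fs) < 1 := by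
    by_cases hfs0 : fs = 0
    · rw [hfs0, map_zero, map_zero]
      exact zero_lt_one
    · obtain ⟨u, hu, hvu, -⟩ := h.exists_valuation_eq fs hfs0
      rw [hvu]
      exact hfs_val u hu
  obtain ⟨ds, hdsF, -, hds⟩ := exists_pow_sub_self_eq_of_valuation_lt_one V F hp.out.two_le
    (h.linearCombination_mem_subfield fs) hlc_s
  refine ⟨f₁, dc + ds, F.add_mem (h.subfield_le_subfield hdcK) hdsF, ?_, ?_, ?_⟩
  · rw [hf₁, Finsupp.support_filter]
    exact Finset.filter_subset _ _
  · intro u hu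
    have hu' := hu
    rw [hf₁, Finsupp.support_filter, Finset.mem_filter] at hu'
    have hval : f₁ u = f u := by rw [hf₁, Finsupp.filter_apply, if_pos hu'.2]
    rw [hval]
    exact hu'.2
  · rw [pow_sub_self_add, hdc, hds, hlc_c.symm]
    conv_lhs => rw [hsplit, hsplit2]
    rw [map_add, map_add]
    ring

end IsLiftedFrobeniusClosedBasisRing

/-! #### The `p`-depth of an element and the termination measure -/

/-- The `p`-depth of `u` in `F`: the least `ν` such that `u` has no `p^ν`-th root in `F` (and `0`
if there is none). [folklore] -/
def pDepth (F : Subfield Ω) (p : ℕ) (u : Ω) : ℕ :=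
  haveI := Classical.propDecidable
  if hex : ∃ ν : ℕ, ∀ w ∈ F, w ^ p ^ ν ≠ u then Nat.find hex else 0

/-- **The `p`-depth drops under extraction of a `p`-th root**: if `w ∈ F` with `w^p = u` and both
have finite `p`-depth, then the `p`-depth of `w` is smaller than that of `u`. [folklore] -/
theorem pDepth_lt_of_pow_eq {u w : Ω} (hwF : w ∈ F) (hwu : w ^ p = u)
    (hexw : ∃ ν : ℕ, ∀ w' ∈ F, w' ^ p ^ ν ≠ w) (hexu : ∃ ν : ℕ, ∀ w' ∈ F, w' ^ p ^ ν ≠ u) :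
    pDepth F p w < pDepth F p u := by
  classical
  unfold pDepth
  rw [dif_pos hexw, dif_pos hexu]
  have hspec := Nat.find_spec hexu
  -- the depth `ν` of `u` is positive
  obtain ⟨k, hk⟩ : ∃ k, Nat.find hexu = k + 1 := by
    refine Nat.exists_eq_add_one_of_ne_zero fun h0 => ?_
    rw [h0] at hspec
    exact hspec u (by rw [← hwu]; exact F.pow_mem hwF p) (by rw [pow_zero, pow_one])
  rw [hk] at hspec ⊢
  -- `w` has no `p^k`-th root
  have hw : ∀ w' ∈ F, w' ^ p ^ k ≠ w := by
    intro w' hw' h'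
    exact hspec w' hw' (by rw [pow_succ, pow_mul, h', hwu])
  exact Nat.lt_succ_of_le (Nat.find_le hw)

/-- The termination measure of the reduction: total `p`-depth (plus one) over the support.
[folklore] -/
def depthMeasure (F : Subfield Ω) (p : ℕ) {B : Set Ω} {K : Subfield Ω} (f : B →₀ K) : ℕ :=
  ∑ u ∈ f.support, (pDepth F p (u : Ω) + 1)

omit [Field Ω] in
/-- The measure is monotone in the support. [folklore] -/
theorem depthMeasure_le_of_support_subset {Ω : Type u} [Field Ω] (F : Subfield Ω) (p : ℕ)
    {B : Set Ω} {K : Subfield Ω} {f g : B →₀ K} (hfg : f.support ⊆ g.support) :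
    depthMeasure F p f ≤ depthMeasure F p g :=
  Finset.sum_le_sum_of_subset hfg

namespace IsLiftedFrobeniusClosedBasisRing

variable (h : IsLiftedFrobeniusClosedBasisRing V p K F R B)
include h

/-- **Step C of the reduction (replace a `p`-th power)**: if `u₀ = w₀^p` occurs in `∑ cᵤ u`, then
replacing the term `c u₀ = (c' w₀)^p` (`c'^p = c`, `K` perfect) by `c' w₀` changes the sum by
`℘(c'w₀) ∈ ℘(F)` (Kuhlmann 2010, proof of Prop. 4.12: "we can replace a summand … After a finite
repetition of this procedure …"); the measure drops. PROVED. [cite: Kuhlmann2010, Prop. 4.12 (proof)] -/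
theorem exists_replace [hp : Fact p.Prime] [CharP Ω p] (hK : IsAlgClosed K)
    (hfin : ∀ u ∈ B, u ≠ 1 → ∃ ν : ℕ, ∀ w ∈ F, w ^ p ^ ν ≠ u)
    (f : B →₀ K) (hf1 : ∀ u ∈ f.support, (u : Ω) ≠ 1) {u₀ : B} (hu₀ : u₀ ∈ f.support) {w₀ : B}
    (hw₀ : (w₀ : Ω) ^ p = u₀) :
    ∃ (f₂ : B →₀ K) (d : Ω), d ∈ F ∧ depthMeasure F p f₂ < depthMeasure F p f ∧
      (∀ u ∈ f₂.support, (u : Ω) ≠ 1) ∧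
      Finsupp.linearCombination K ((↑) : B → Ω) f -
        Finsupp.linearCombination K ((↑) : B → Ω) f₂ = d ^ p - d := by
  classical
  have hu₀1 : (u₀ : Ω) ≠ 1 := hf1 u₀ hu₀
  have hw₀1 : (w₀ : Ω) ≠ 1 := fun h1 => hu₀1 (by rw [← hw₀, h1, one_pow])
  obtain ⟨c', hc'K, hc'⟩ := exists_pow_eq_of_isAlgClosed (p := p) hK (f u₀).2
  set f₂ : B →₀ K := f.erase u₀ + Finsupp.single w₀ ⟨c', hc'K⟩ with hf₂
  have hsupp : f₂.support ⊆ f.support.erase u₀ ∪ {w₀} := by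
    refine Finsupp.support_add.trans (Finset.union_subset_union ?_ Finsupp.support_single_subset)
    rw [Finsupp.support_erase]
  refine ⟨f₂, c' * w₀, F.mul_mem (h.subfield_le_subfield hc'K) (h.subset_subfield w₀.2), ?_, ?_, ?_⟩
  · -- the measure drops: `pDepth w₀ < pDepth u₀`
    have hlt : pDepth F p (w₀ : Ω) < pDepth F p (u₀ : Ω) :=
      pDepth_lt_of_pow_eq (h.subset_subfield w₀.2) hw₀ (hfin _ w₀.2 hw₀1) (hfin _ u₀.2 hu₀1)
    calc depthMeasure F p f₂
        ≤ ∑ u ∈ f.support.erase u₀ ∪ {w₀}, (pDepth F p (u : Ω) + 1) := Finset.sum_le_sum_of_subset hsupp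
      _ ≤ ∑ u ∈ f.support.erase u₀, (pDepth F p (u : Ω) + 1) + ∑ u ∈ {w₀}, (pDepth F p (u : Ω) + 1) := by
          rw [← Finset.sum_union_inter]
          exact Nat.le_add_right _ _
      _ = ∑ u ∈ f.support.erase u₀, (pDepth F p (u : Ω) + 1) + (pDepth F p (w₀ : Ω) + 1) := by
          rw [Finset.sum_singleton]
      _ < ∑ u ∈ f.support.erase u₀, (pDepth F p (u : Ω) + 1) + (pDepth F p (u₀ : Ω) + 1) := by
          exact Nat.add_lt_add_left (Nat.succ_lt_succ hlt) _
      _ = depthMeasure F p f := Finset.sum_erase_add _ _ hu₀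
  · intro u hu
    rcases Finset.mem_union.mp (hsupp hu) with hu' | hu'
    · exact hf1 u (Finset.mem_of_mem_erase hu')
    · rw [Finset.mem_singleton] at hu'
      rw [hu']
      exact hw₀1
  · have herase : Finsupp.linearCombination K ((↑) : B → Ω) (f.erase u₀) =
        Finsupp.linearCombination K ((↑) : B → Ω) f - (f u₀ : Ω) * u₀ := by
      have h1 := congrArg (Finsupp.linearCombination K ((↑) : B → Ω)) (Finsupp.erase_add_single u₀ f)
      rw [map_add, Finsupp.linearCombination_single, Algebra.smul_def] at h1
      rw [← h1]
      change _ = _ + (f u₀ : Ω) * u₀ - (f u₀ : Ω) * u₀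
      ring
    rw [hf₂, map_add, herase, Finsupp.linearCombination_single, Algebra.smul_def]
    change _ - (_ + c' * (w₀ : Ω)) = _
    rw [mul_pow, hc', hw₀]
    ring

/-- **The reduction to the Artin–Schreier normal form** (Kuhlmann 2010, Prop. 4.12: "`ϑ^p - ϑ =
∑ cᵢuᵢ` … such that no element `uᵢ ≠ 1` is a `p`-th power in `𝓑`, and `vcᵢuᵢ = vcᵢ ≤ 0`"; here,
over an algebraically closed `K`, the constant term is absorbed as well): every `K`-linear
combination of `𝓑` is congruent modulo `℘(F)` to one whose support consists of non-`p`-th-powers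
`u ≠ 1` with coefficients of value `≤ 0`. PROVED by well-founded iteration of Steps B and C
(finite `p`-depth). [cite: Kuhlmann2010, Prop. 4.12 (proof)] -/
theorem exists_reduced [hp : Fact p.Prime] [CharP Ω p] [HenselianLocalRing (V.comap (algebraMap F Ω))]
    (hK : IsAlgClosed K) (hfin : ∀ u ∈ B, u ≠ 1 → ∃ ν : ℕ, ∀ w ∈ F, w ^ p ^ ν ≠ u) (f : B →₀ K) :
    ∃ (g : B →₀ K) (d : Ω), d ∈ F ∧
      (∀ u ∈ g.support, (u : Ω) ≠ 1 ∧ 1 ≤ V.valuation (g u : Ω) ∧ ∀ w ∈ B, w ^ p ≠ (u : Ω)) ∧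
      Finsupp.linearCombination K ((↑) : B → Ω) f -
        Finsupp.linearCombination K ((↑) : B → Ω) g = d ^ p - d := by
  suffices H : ∀ n : ℕ, ∀ f : B →₀ K, depthMeasure F p f ≤ n →
      ∃ (g : B →₀ K) (d : Ω), d ∈ F ∧
        (∀ u ∈ g.support, (u : Ω) ≠ 1 ∧ 1 ≤ V.valuation (g u : Ω) ∧ ∀ w ∈ B, w ^ p ≠ (u : Ω)) ∧
        Finsupp.linearCombination K ((↑) : B → Ω) f -
          Finsupp.linearCombination K ((↑) : B → Ω) g = d ^ p - d from H _ f le_rfl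
  intro n
  induction n using Nat.strong_induction_on with
  | _ n ih =>
    intro f hf
    -- Step B
    obtain ⟨f₁, d₁, hd₁F, hsupp₁, hprop₁, heq₁⟩ := h.exists_drop hK f
    have hμ₁ : depthMeasure F p f₁ ≤ n := (depthMeasure_le_of_support_subset F p hsupp₁).trans hf
    by_cases hex : ∃ u₀ ∈ f₁.support, ∃ w₀ : B, (w₀ : Ω) ^ p = u₀
    · -- Step C, then the induction hypothesis
      obtain ⟨u₀, hu₀, w₀, hw₀⟩ := hex
      obtain ⟨f₂, d₂, hd₂F, hμ₂, -, heq₂⟩ :=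
        h.exists_replace hK hfin f₁ (fun u hu => (hprop₁ u hu).1) hu₀ hw₀
      obtain ⟨g, d₃, hd₃F, hprop, heq₃⟩ := ih (depthMeasure F p f₂) (lt_of_lt_of_le hμ₂ hμ₁) f₂ le_rfl
      refine ⟨g, d₁ + d₂ + d₃, F.add_mem (F.add_mem hd₁F hd₂F) hd₃F, hprop, ?_⟩
      rw [pow_sub_self_add, pow_sub_self_add, ← heq₁, ← heq₂, ← heq₃]
      ring
    · push Not at hex
      refine ⟨f₁, d₁, hd₁F, fun u hu => ⟨(hprop₁ u hu).1, (hprop₁ u hu).2, fun w hw hwu => ?_⟩, heq₁⟩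
      exact hex u hu ⟨w, hw⟩ hwu

end IsLiftedFrobeniusClosedBasisRing

/-! #### Valuations of Artin–Schreier generators -/

/-- **`vϑ < 0 ⇒ v(ϑ^p - ϑ) = p·vϑ < 0`** (multiplicatively: `1 < vϑ ⇒ v(ϑ^p - ϑ) = (vϑ)^p > 1`;
source: "`vϑ^p = pvϑ < vϑ` and consequently `pvϑ = vϑ^p = vcⱼxʲ` by the ultrametric triangle
law"). [cite: Kuhlmann2010, Prop. 4.5 (proof)] -/
theorem valuation_pow_sub_self_of_one_lt (hp2 : 2 ≤ p) {ϑ : Ω} (hϑ : 1 < V.valuation ϑ) :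
    V.valuation (ϑ ^ p - ϑ) = V.valuation ϑ ^ p ∧ 1 < V.valuation ϑ ^ p := by
  have hvϑ0 : 0 < V.valuation ϑ := lt_trans zero_lt_one hϑ
  have hlt : V.valuation ϑ < V.valuation (ϑ ^ p) := by
    rw [map_pow]
    obtain ⟨k, hk⟩ := Nat.exists_eq_add_of_le hp2
    rw [hk, show 2 + k = (k + 1) + 1 by ring, pow_succ]
    calc V.valuation ϑ = 1 * V.valuation ϑ := (one_mul _).symm
      _ < V.valuation ϑ ^ (k + 1) * V.valuation ϑ :=
          mul_lt_mul_of_pos_right (one_lt_pow' hϑ (Nat.succ_ne_zero k)) hvϑ0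
  refine ⟨?_, one_lt_pow' hϑ (by omega)⟩
  rw [V.valuation.map_sub_eq_of_lt_left hlt, map_pow]

/-- If `v(ϑ^p - ϑ) > 1` then `vϑ > 1` and `v(ϑ^p - ϑ) = (vϑ)^p`. [cite: Kuhlmann2010, Prop. 4.12 (proof: "we find that `vϑ = (1/p)vcⱼuⱼ`")] -/
theorem valuation_eq_pow_of_one_lt (hp2 : 2 ≤ p) {ϑ : Ω} (ha : 1 < V.valuation (ϑ ^ p - ϑ)) :
    1 < V.valuation ϑ ∧ V.valuation (ϑ ^ p - ϑ) = V.valuation ϑ ^ p := by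
  have hϑ : 1 < V.valuation ϑ := by
    by_contra hle
    push Not at hle
    have : V.valuation (ϑ ^ p - ϑ) ≤ 1 := by
      refine Valuation.map_sub_le _ ?_ hle
      rw [map_pow]
      exact pow_le_one' hle p
    exact not_lt.mpr this ha
  exact ⟨hϑ, (valuation_pow_sub_self_of_one_lt hp2 hϑ).1⟩

/-- If `v(ϑ^p - ϑ) ≤ 1` then `vϑ ≤ 1`. [cite: Kuhlmann2010, Prop. 4.12 (proof: "Then also `ϑ` has value `0`")] -/
theorem valuation_le_one_of_pow_sub_self (hp2 : 2 ≤ p) {ϑ : Ω} (ha : V.valuation (ϑ ^ p - ϑ) ≤ 1) :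
    V.valuation ϑ ≤ 1 := by
  by_contra hlt
  push Not at hlt
  obtain ⟨heq, hgt⟩ := valuation_pow_sub_self_of_one_lt (V := V) hp2 hlt
  rw [heq] at ha
  exact not_lt.mpr ha hgt

/-! #### From a residue of degree `p` to defectlessness -/

/-- **An element of `Ev` of degree `[E : F]` over `Fv` makes `(E|F,v)` defectless**: then
`[Ev : Fv] ≥ [E : F]`, and the fundamental inequality `(vE : vF)·[Ev : Fv] ≤ [E : F]` forces
`(vE : vF) = 1`, `[Ev : Fv] = [E : F]` (source: "Thus, `[Ē:F̄] ≥ p`. By the fundamental inequality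
(1), equality holds"). PROVED. [cite: Kuhlmann2010, Prop. 4.12 (proof)] -/
theorem isDefectlessExtension_of_finrank_residue_adjoin_eq {F E : Subfield Ω} (hle : F ≤ E) {n : ℕ}
    (hn : 0 < n) (hrel : Subfield.relfinrank F E = n) {r : ResidueField V}
    (hr : r ∈ residueSubfield E V)
    (hdeg : Module.finrank (residueSubfield F V)
      (IntermediateField.adjoin (residueSubfield F V) ({r} : Set (ResidueField V))) = n) :
    IsDefectlessExtension V F E := by
  have hpos : 0 < Subfield.relfinrank F E := by rw [hrel]; exact hn
  obtain ⟨he, hf, hef⟩ := relIndex_mul_relfinrank_le_relfinrank V hle hpos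
  have hAB : residueSubfield F V ≤ residueSubfield E V := residueSubfield_subfield_mono hle
  -- `[Ev : Fv] ≥ n`
  have hfn : n ≤ (residueSubfield F V).relfinrank (residueSubfield E V) := by
    rw [Subfield.relfinrank_eq_finrank_of_le hAB] at hf ⊢
    haveI : FiniteDimensional (residueSubfield F V) (Subfield.extendScalars hAB) :=
      Module.finite_of_finrank_pos hf
    have hadj : IntermediateField.adjoin (residueSubfield F V) ({r} : Set (ResidueField V)) ≤
        Subfield.extendScalars hAB :=
      IntermediateField.adjoin_simple_le_iff.mpr ((Subfield.mem_extendScalars (h := hAB)).mpr hr)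
    rw [← hdeg]
    exact IntermediateField.finrank_le_of_le_right hadj
  -- `[Ev : Fv] ≤ e·[Ev : Fv] ≤ n`
  have hfn' : (residueSubfield F V).relfinrank (residueSubfield E V) ≤ n := by
    rw [← hrel]
    exact le_trans (Nat.le_mul_of_pos_left _ he) hef
  exact isDefectlessExtension_of_relfinrank_residueSubfield_eq hle hpos
    ((le_antisymm hfn' hfn).trans hrel.symm)

namespace IsLiftedFrobeniusClosedBasisRing

variable (h : IsLiftedFrobeniusClosedBasisRing V p K F R B)
include h

/-- The `K̄`-valued coefficient family of residues of a `K`-linear combination with coefficients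
in `V`. [folklore] -/
theorem exists_resid_finsupp (g : B →₀ K) (hg : ∀ u, (g u : Ω) ∈ V) :
    ∃ e : B →₀ residueSubfield K V,
      (∀ u, ((e u : residueSubfield K V) : ResidueField V) = resid V (g u : Ω)) ∧
      Finsupp.linearCombination (residueSubfield K V) (fun u : B => resid V (u : Ω)) e =
        resid V (Finsupp.linearCombination K ((↑) : B → Ω) g) := by
  classical
  refine ⟨Finsupp.onFinset g.support
    (fun u => ⟨resid V (g u : Ω), resid_mem_residueSubfield V (g u).2⟩) ?_, fun u => rfl, ?_⟩
  · intro u hu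
    by_contra hnot
    apply hu
    apply Subtype.ext
    change resid V (g u : Ω) = 0
    rw [Finsupp.notMem_support_iff.mp hnot]
    exact resid_zero V
  · rw [Finsupp.linearCombination_onFinset, h.resid_linearCombination g hg]
    refine Finset.sum_congr rfl fun u _ => ?_
    rw [Algebra.smul_def]
    rfl

/-- **Case 1 of Prop. 4.12: some coefficient has negative value** ("If `vcⱼuⱼ < 0` for some `j ∈ I`
with `uⱼ ≠ 1`, then `Ē|F̄` is purely inseparable of degree `p`": with `j` of minimal value,
`d = cⱼ^{-1/p} ∈ K` and `χ = dϑ`, "`χ̄^p = ∑ d̄ᵢūᵢ` … since `ūⱼ ≠ 1` is not a `p`-th power in `𝓑̄`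
… we can infer from part b) of Lemma 4.8 that `χ̄ ∉ F̄`. Thus, `[Ē:F̄] ≥ p`"). Here: the residue
`χ̄ ∈ Ev` has degree `p` over `Fv`. PROVED. [cite: Kuhlmann2010, Prop. 4.12 (proof, case `vcⱼuⱼ < 0`)] -/
theorem exists_residue_degree_eq_of_one_lt [hp : Fact p.Prime] [CharP Ω p] [CharP (ResidueField V) p]
    (hK : IsAlgClosed K) {E : Subfield Ω} (hFE : F ≤ E) (g : B →₀ K)
    (hred : ∀ u ∈ g.support, ∀ w ∈ B, w ^ p ≠ (u : Ω))
    (hbig : ∃ u ∈ g.support, 1 < V.valuation (g u : Ω)) {ϑ : Ω} (hϑE : ϑ ∈ E)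
    (hϑ : ϑ ^ p - ϑ = Finsupp.linearCombination K ((↑) : B → Ω) g) :
    ∃ r ∈ residueSubfield E V, Module.finrank (residueSubfield F V)
      (IntermediateField.adjoin (residueSubfield F V) ({r} : Set (ResidueField V))) = p := by
  classical
  have hp2 : 2 ≤ p := hp.out.two_le
  obtain ⟨u₁, hu₁, hvu₁⟩ := hbig
  have hg0 : g ≠ 0 := by
    rintro rfl
    simp at hu₁
  -- `j` with `vcⱼ` maximal (= `va'`)
  obtain ⟨j, hj, hvj, hmax⟩ := h.exists_valuation_eq g hg0
  set γ := V.valuation (g j : Ω) with hγ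
  have hγ1 : 1 < γ := lt_of_lt_of_le hvu₁ (hmax u₁ hu₁)
  have hγ0 : 0 < γ := lt_trans zero_lt_one hγ1
  have hgj0 : (g j : Ω) ≠ 0 := (Valuation.ne_zero_iff _).mp hγ0.ne'
  -- `d₁ ∈ K` with `d₁^p = cⱼ⁻¹`
  obtain ⟨d₁, hd₁K, hd₁⟩ := exists_pow_eq_of_isAlgClosed (p := p) hK (K.inv_mem (g j).2)
  have hvd₁p : V.valuation d₁ ^ p = γ⁻¹ := by rw [← map_pow, hd₁, map_inv₀]
  have hvd₁ : V.valuation d₁ < 1 := by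
    by_contra hle
    push Not at hle
    have : 1 ≤ V.valuation d₁ ^ p := one_le_pow_of_one_le' hle p
    rw [hvd₁p] at this
    exact not_lt.mpr this (inv_lt_one_of_one_lt₀ hγ1)
  -- `vϑ`: `v(ϑ^p - ϑ) = γ > 1`, so `(vϑ)^p = γ`
  have hva' : V.valuation (ϑ ^ p - ϑ) = γ := by rw [hϑ, hvj]
  obtain ⟨hvϑ1, hvϑp⟩ := valuation_eq_pow_of_one_lt (V := V) hp2 (by rw [hva']; exact hγ1)
  rw [hva'] at hvϑp
  -- `χ = d₁ϑ` is a unit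
  set χ : Ω := d₁ * ϑ with hχ
  have hvχ : V.valuation χ = 1 := by
    have hχp : V.valuation χ ^ p = 1 := by
      rw [hχ, map_mul, mul_pow, hvd₁p, ← hvϑp, inv_mul_cancel₀ hγ0.ne']
    rcases lt_trichotomy (V.valuation χ) 1 with hlt | heq | hgt
    · exact absurd hχp (pow_lt_one' hlt hp.out.ne_zero).ne
    · exact heq
    · exact absurd hχp (one_lt_pow' hgt hp.out.ne_zero).ne'
  have hχV : χ ∈ V := (V.valuation_le_one_iff χ).mp hvχ.le
  have hd₁F : d₁ ∈ F := h.subfield_le_subfield hd₁K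
  have hχE : χ ∈ E := E.mul_mem (hFE hd₁F) hϑE
  -- the rescaled combination `a'' = cⱼ⁻¹ a' = ∑ (cᵤ/cⱼ) u`, coefficients of value `≤ 1`
  set g'' : B →₀ K := (g j)⁻¹ • g with hg''
  have hg''u : ∀ u, (g'' u : Ω) = ((g j : Ω))⁻¹ * (g u : Ω) := fun u => by
    rw [hg'', Finsupp.smul_apply, smul_eq_mul]
    rfl
  have hg''val : ∀ u, V.valuation (g'' u : Ω) ≤ 1 := by
    intro u
    rw [hg''u, map_mul, map_inv₀]
    by_cases hu : u ∈ g.support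
    · rw [inv_mul_le_one₀ hγ0]
      exact hmax u hu
    · rw [Finsupp.notMem_support_iff.mp hu]
      simp
  have hg''V : ∀ u, (g'' u : Ω) ∈ V := fun u => (V.valuation_le_one_iff _).mp (hg''val u)
  have hg''j : (g'' j : Ω) = 1 := by rw [hg''u, inv_mul_cancel₀ hgj0]
  set a'' : Ω := Finsupp.linearCombination K ((↑) : B → Ω) g'' with ha''
  have ha''eq : a'' = d₁ ^ p * (ϑ ^ p - ϑ) := by
    rw [ha'', hg'', map_smul, hd₁, hϑ, Algebra.smul_def]
    rfl
  have ha''F : a'' ∈ F := h.linearCombination_mem_subfield g''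
  have ha''V : a'' ∈ V := h.linearCombination_mem_valuationSubring g'' hg''val
  -- `χ^p = a'' + d₁^{p-1} χ` with `v(d₁^{p-1}χ) < 1`
  have hχp : χ ^ p = a'' + d₁ ^ (p - 1) * χ := by
    rw [ha''eq, hχ, mul_pow]
    obtain ⟨k, hk⟩ := Nat.exists_eq_add_of_le hp2
    rw [hk, show 2 + k - 1 = k + 1 by omega, show 2 + k = (k + 1) + 1 by omega]
    ring
  have hsmall : V.valuation (d₁ ^ (p - 1) * χ) < 1 := by
    rw [map_mul, hvχ, mul_one, map_pow]
    exact pow_lt_one' hvd₁ (by omega)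
  have hsmallV : d₁ ^ (p - 1) * χ ∈ V := (V.valuation_le_one_iff _).mp hsmall.le
  have hresχp : resid V χ ^ p = resid V a'' := by
    rw [← resid_pow V hχV, hχp, resid_add V ha''V hsmallV, (resid_eq_zero_iff V hsmallV).mpr hsmall,
      add_zero]
  -- the residue of `a''` as a `K̄`-combination of the `ū`
  obtain ⟨e, he, hlce⟩ := h.exists_resid_finsupp g'' hg''V
  have hej : j ∈ e.support := by
    rw [Finsupp.mem_support_iff]
    intro h0
    have := he j
    rw [h0, hg''j, resid_one] at this
    exact zero_ne_one this
  -- `χ̄ ∉ Fv` by Lemma 4.8 (b)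
  have hnotin : resid V χ ∉ residueSubfield F V := by
    intro hin
    obtain ⟨w', hw'B, hw'⟩ := h.exists_pow_eq_of_linearCombination_resid_eq_pow e hin
      (by rw [hlce, ← ha'', hresχp]) j hej
    exact hred j hj w' hw'B hw'
  -- the residue `χ̄ ∈ Ev` has degree `p` over `Fv`: `X^p - ā''` is its minimal polynomial
  have hsF : resid V χ ^ p ∈ residueSubfield F V := by
    rw [hresχp]
    exact resid_mem_residueSubfield V ha''F
  refine ⟨resid V χ, resid_mem_residueSubfield V hχE, ?_⟩
  refine finrank_adjoin_simple_eq_of_not_mem_range p (F := residueSubfield F V)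
    (c := ⟨resid V χ ^ p, hsF⟩) rfl ?_
  rintro ⟨s, hs⟩
  exact hnotin (by rw [← hs]; exact s.2)

/-- **Case 2 of Prop. 4.12: all coefficients have value `0`** ("Then also `ϑ` has value `0`, and
`ϑ̄^p - ϑ̄ = ∑ c̄ᵢūᵢ`. If the polynomial `X^p - X - ∑ c̄ᵢūᵢ` were reducible, then Hensel's Lemma
would yield that `[E:F] < p` … Hence `[Ē:F̄] ≥ p`"). Here: a root in `Fv` of the residue
polynomial lifts, by `𝓜_F ⊆ ℘(F)` ((4.6), Hensel's Lemma), to `a' ∈ ℘(F)`, which is excluded; so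
`ϑ̄ ∈ Ev` has degree `p` over `Fv` (Lang VI Thm. 6.4 (ii), `Literature.FieldTheory.ArtinSchreier`).
PROVED. [cite: Kuhlmann2010, Prop. 4.12 (proof, case `vcᵢuᵢ = 0`)] -/
theorem exists_residue_degree_eq_of_forall_eq_one [hp : Fact p.Prime] [CharP Ω p]
    [CharP (ResidueField V) p] [HenselianLocalRing (V.comap (algebraMap F Ω))]
    {E : Subfield Ω} (g : B →₀ K) (hval : ∀ u ∈ g.support, V.valuation (g u : Ω) = 1)
    {ϑ : Ω} (hϑE : ϑ ∈ E) (hϑ : ϑ ^ p - ϑ = Finsupp.linearCombination K ((↑) : B → Ω) g)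
    (hnot : ∀ d ∈ F, Finsupp.linearCombination K ((↑) : B → Ω) g ≠ d ^ p - d) :
    ∃ r ∈ residueSubfield E V, Module.finrank (residueSubfield F V)
      (IntermediateField.adjoin (residueSubfield F V) ({r} : Set (ResidueField V))) = p := by
  classical
  have hp2 : 2 ≤ p := hp.out.two_le
  haveI : CharP (residueSubfield F V) p :=
    (algebraMap (residueSubfield F V) (ResidueField V)).charP
      (algebraMap (residueSubfield F V) (ResidueField V)).injective p
  set a' : Ω := Finsupp.linearCombination K ((↑) : B → Ω) g with ha'
  have hgval : ∀ u, V.valuation (g u : Ω) ≤ 1 := by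
    intro u
    by_cases hu : u ∈ g.support
    · exact (hval u hu).le
    · rw [Finsupp.notMem_support_iff.mp hu]
      simp
  have ha'V : a' ∈ V := h.linearCombination_mem_valuationSubring g hgval
  have ha'F : a' ∈ F := h.linearCombination_mem_subfield g
  -- `vϑ ≤ 1`
  have hvϑ : V.valuation ϑ ≤ 1 :=
    valuation_le_one_of_pow_sub_self (V := V) hp2 (by rw [hϑ]; exact (V.valuation_le_one_iff _).mpr ha'V)
  have hϑV : ϑ ∈ V := (V.valuation_le_one_iff _).mp hvϑ
  -- `ϑ̄^p - ϑ̄ = ā'`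
  have hres : resid V ϑ ^ p - resid V ϑ = resid V a' := by
    rw [← resid_pow V hϑV, ← resid_sub V (V.pow_mem hϑV p) hϑV, hϑ]
  -- `ā' ∉ ℘(Fv)`: a root would lift
  have hc : ∀ s : residueSubfield F V, s ^ p - s ≠ ⟨resid V a', resid_mem_residueSubfield V ha'F⟩ := by
    intro s hs
    obtain ⟨ρ, hρF, hρV, hρ⟩ := exists_resid_eq_of_mem_residueSubfield V s.2
    have hs' : resid V ρ ^ p - resid V ρ = resid V a' := by
      have := congrArg (fun z : residueSubfield F V => (z : ResidueField V)) hs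
      simpa [hρ] using this
    -- `a' - ℘(ρ)` has value `< 1`
    have hmem : a' - (ρ ^ p - ρ) ∈ V := V.sub_mem ha'V (V.sub_mem (V.pow_mem hρV p) hρV)
    have hsmall : V.valuation (a' - (ρ ^ p - ρ)) < 1 := by
      rw [← resid_eq_zero_iff V hmem, resid_sub V ha'V (V.sub_mem (V.pow_mem hρV p) hρV),
        resid_sub V (V.pow_mem hρV p) hρV, resid_pow V hρV, hs', sub_self]
    obtain ⟨d', hd'F, -, hd'⟩ := exists_pow_sub_self_eq_of_valuation_lt_one V F hp2
      (F.sub_mem ha'F (F.sub_mem (F.pow_mem hρF p) hρF)) hsmall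
    refine hnot (ρ + d') (F.add_mem hρF hd'F) ?_
    rw [pow_sub_self_add, hd']
    ring
  refine ⟨resid V ϑ, resid_mem_residueSubfield V hϑE, ?_⟩
  exact Literature.FieldTheory.ArtinSchreier.finrank_adjoin_simple_eq p
    (F := residueSubfield F V) (E := ResidueField V) (c := ⟨resid V a', resid_mem_residueSubfield V ha'F⟩)
    hres hc

end IsLiftedFrobeniusClosedBasisRing

/-! #### The fields of the class: separability over `K(x)` -/

/-- **`F|K(x)` is separable** for `F` finite unramified over the henselization `K(x)^h`
(unramified ⇒ separable, `IsUnramifiedOver.isSeparable`; `K(x)^h|K(x)` is separable).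
PROVED. [cite: Kuhlmann2010, Section 2.5 and Lemma 2.2] -/
theorem isSeparable_of_isUnramifiedOver_henselization [IsAlgClosed Ω] {K F : Subfield Ω} {x : Ω}
    (hunr : IsUnramifiedOver V
      (henselization V (IntermediateField.adjoin K ({x} : Set Ω)).toSubfield) F) :
    ∀ z ∈ F, IsSeparable (IntermediateField.adjoin K ({x} : Set Ω)).toSubfield z := by
  intro z hz
  set Kx : Subfield Ω := (IntermediateField.adjoin K ({x} : Set Ω)).toSubfield with hKxdef
  set H : Subfield Ω := henselization V Kx with hHdef
  have hKxH : Kx ≤ H := le_henselization V Kx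
  have h1 : IsSeparable H z := hunr.isSeparable V hz
  let H' : IntermediateField Kx Ω := Subfield.extendScalars hKxH
  haveI : Algebra.IsSeparable Kx H' := ⟨fun y => by
    have hy : IsSeparable Kx (y : Ω) :=
      isSeparable_of_mem_henselization V Kx ((Subfield.mem_extendScalars (h := hKxH)).mp y.2)
    exact (isSeparable_map_iff (IsScalarTower.toAlgHom Kx H' Ω) (algebraMap H' Ω).injective).mp hy⟩
  let e : H →+* H' :=
    { toFun := fun y => ⟨y.1, (Subfield.mem_extendScalars (h := hKxH)).mpr y.2⟩
      map_one' := rfl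
      map_mul' := fun _ _ => rfl
      map_zero' := rfl
      map_add' := fun _ _ => rfl }
  letI : Algebra H H' := e.toAlgebra
  haveI : IsScalarTower H H' Ω := IsScalarTower.of_algebraMap_eq fun _ => rfl
  have h2 : IsSeparable H' z := IsSeparable.tower_top H' h1
  exact IsSeparable.of_algebra_isSeparable_of_isSeparable (F := Kx) (E := H') h2

/-! ### Assembly: Prop. 4.1 (residue-transcendental, equal characteristic) from Lemma 4.10 and Hensel's Lemma -/

/-- **Kuhlmann 2010, Prop. 4.1 in the residue-transcendental case of equal characteristic, PROVED
from Lemma 4.10 (`Kuhlmann2010Lemma410`) and Hensel's Lemma (`Kuhlmann2010HenselsLemma`)** along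
the printed proof of Prop. 4.12: for `F` in the class over an algebraically closed `K` and
`E|F` Galois of degree `p = char`, write `E = F(ϑ₀)` with `a₀ = ϑ₀^p - ϑ₀ ∈ F` ((4.4),
`Literature.FieldTheory.ArtinSchreier`); by Lemma 4.9 (`F = R + ℘(F)`) and the reduction
(`exists_reduced`: drop constants and terms of positive value, replace `p`-th powers —
finitely often by finite `p`-depth) `a₀ ≡ a' = ∑ cᵤu (mod ℘(F))` with non-`p`-th-powers `u ≠ 1`
and `vcᵤ ≤ 0`, and `E = F(ϑ)`, `ϑ^p - ϑ = a'` ((4.5)); `a' ∉ ℘(F)` since `[E : F] = p`. If some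
`vcⱼ < 0`, Case 1 (`exists_residue_degree_eq_of_one_lt`, Lemma 4.8); otherwise Case 2
(`exists_residue_degree_eq_of_forall_eq_one`, Hensel). Either way `Ev` contains an element of
degree `p` over `Fv`, so `[Ev : Fv] = p = [E : F]` and `(E|F,v)` is defectless (the first
alternative of Prop. 4.1). [cite: Kuhlmann2010, Prop. 4.1 and Prop. 4.12 (proof)] -/
theorem Kuhlmann2010Prop41RTEqualChar.of_parts (h410 : Kuhlmann2010Lemma410.{u})
    (hH : Kuhlmann2010HenselsLemma.{u}) : Kuhlmann2010Prop41RTEqualChar.{u} := by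
  intro Ω _ _ V p _ _ hp K F E hK hF hstep
  classical
  left
  haveI : Fact p.Prime := ⟨hp⟩
  haveI : CharP F p := (algebraMap F Ω).charP (algebraMap F Ω).injective p
  have hp2 : 2 ≤ p := hp.two_le
  -- the lifted Frobenius-closed basis, Hensel's Lemma, rank one, `vF = vK`
  obtain ⟨R, B, hLFC⟩ := h410 Ω V p hp K F hK hF
  haveI : HenselianLocalRing (V.comap (algebraMap F Ω)) := hH F _ hF.isHenselianField
  have hr1 : IsRankOneValued V F :=
    hF.isRankOneValued_of_algebraic le_rfl fun a ha => isAlgebraic_algebraMap (⟨a, ha⟩ : F)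
  have hv : valueSubgroup F V = valueSubgroup K V := hF.valueSubgroup_eq
  -- finite `p`-depth on `𝓑 ∖ {1}`
  obtain ⟨x, -, -, hunr⟩ := id hF
  have hKF : K ≤ F := hLFC.subfield_le_subfield
  have hxF : x ∈ F :=
    hunr.le (le_henselization V _ (IntermediateField.subset_adjoin K ({x} : Set Ω) rfl))
  have hsep := isSeparable_of_isUnramifiedOver_henselization hunr
  have hfin : ∀ u ∈ B, u ≠ 1 → ∃ ν : ℕ, ∀ w ∈ F, w ^ p ^ ν ≠ u := fun u hu hu1 =>
    exists_forall_pow_ne p hK hKF hxF hsep (hLFC.subset_subfield hu) (hLFC.not_mem_subfield hu hu1)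
  -- the Galois step and its Artin–Schreier generator
  obtain ⟨hle, hdeg, hgal⟩ := hstep
  haveI := hgal
  haveI : FiniteDimensional F (Subfield.extendScalars hle) :=
    Module.finite_of_finrank_pos (by rw [hdeg]; exact hp.pos)
  obtain ⟨ϑ₀, hϑ₀E, ⟨a₀', ha₀'⟩, hgen⟩ :=
    Literature.FieldTheory.ArtinSchreier.IntermediateField.exists_generator_pow_sub_self_mem
      (F := F) (L := Ω) (Subfield.extendScalars hle) hdeg
  set a₀ : Ω := ϑ₀ ^ p - ϑ₀ with ha₀
  have ha₀F : a₀ ∈ F := by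
    rw [← ha₀']
    exact a₀'.2
  have hϑ₀E' : ϑ₀ ∈ E := (Subfield.mem_extendScalars (h := hle)).mp hϑ₀E
  -- `a₀ ∉ ℘(F)`: else `ϑ₀ ∈ F` and `[E : F] = 1`
  have hnot₀ : ∀ d ∈ F, a₀ ≠ d ^ p - d := by
    intro d hdF heq
    have h1 : (ϑ₀ - d) ^ p - (ϑ₀ - d) = 0 := by
      rw [Literature.FieldTheory.ArtinSchreier.pow_sub_self_sub p ϑ₀ d, ← ha₀, heq, sub_self]
    obtain ⟨i, -, hi⟩ :=
      Literature.FieldTheory.ArtinSchreier.exists_natCast_eq_of_pow_eq_self p (sub_eq_zero.mp h1)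
    have hϑ₀F : ϑ₀ ∈ F := by
      have : ϑ₀ = d + i := by rw [hi]; ring
      rw [this]
      exact F.add_mem hdF (natCast_mem F i)
    have hbot : Subfield.extendScalars hle = ⊥ := by
      rw [← hgen]
      exact IntermediateField.adjoin_simple_eq_bot_iff.mpr
        (IntermediateField.mem_bot.mpr ⟨⟨ϑ₀, hϑ₀F⟩, rfl⟩)
    rw [hbot, IntermediateField.finrank_bot] at hdeg
    exact hp.one_lt.ne hdeg
  -- `a₀ ≡ a' = ∑ cᵤ u (mod ℘(F))` with the combination reduced
  obtain ⟨r, hrR, d₀, hd₀F, -, hr⟩ := hLFC.exists_mem_add_pow_sub_self hp2 hr1 hv ha₀F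
  obtain ⟨f₀, hf₀⟩ := hLFC.exists_linearCombination_eq hrR
  obtain ⟨g, d₁, hd₁F, hred, hg⟩ := hLFC.exists_reduced hK hfin f₀
  set a' : Ω := Finsupp.linearCombination K ((↑) : B → Ω) g with ha'
  set dd : Ω := d₀ + d₁ with hdd
  have hddF : dd ∈ F := F.add_mem hd₀F hd₁F
  have hrel : a₀ = a' + (dd ^ p - dd) := by
    have h1 : Finsupp.linearCombination K ((↑) : B → Ω) f₀ = a' + (d₁ ^ p - d₁) := by
      rw [← hg]
      ring
    rw [hdd, pow_sub_self_add, hr, ← hf₀, h1]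
    ring
  -- the generator `ϑ = ϑ₀ - dd` with `ϑ^p - ϑ = a'`
  set ϑ : Ω := ϑ₀ - dd with hϑdef
  have hϑ : ϑ ^ p - ϑ = a' := by
    rw [hϑdef, Literature.FieldTheory.ArtinSchreier.pow_sub_self_sub p ϑ₀ dd, ← ha₀, hrel]
    ring
  have hϑE : ϑ ∈ E := E.sub_mem hϑ₀E' (hle hddF)
  have hnot : ∀ d ∈ F, a' ≠ d ^ p - d := by
    intro d hdF heq
    refine hnot₀ (dd + d) (F.add_mem hddF hdF) ?_
    rw [hrel, heq, pow_sub_self_add dd d]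
    ring
  -- in either case a residue of degree `p`
  have hrelF : Subfield.relfinrank F E = p := by
    rw [Subfield.relfinrank_eq_finrank_of_le hle, hdeg]
  have hcases : ∃ rr ∈ residueSubfield E V, Module.finrank (residueSubfield F V)
      (IntermediateField.adjoin (residueSubfield F V) ({rr} : Set (ResidueField V))) = p := by
    by_cases hbig : ∃ u ∈ g.support, 1 < V.valuation (g u : Ω)
    · exact hLFC.exists_residue_degree_eq_of_one_lt hK hle g (fun u hu => (hred u hu).2.2) hbig hϑE hϑ
    · push Not at hbig
      exact hLFC.exists_residue_degree_eq_of_forall_eq_one g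
        (fun u hu => le_antisymm (hbig u hu) (hred u hu).2.1) hϑE hϑ hnot
  obtain ⟨rr, hrr, hdegr⟩ := hcases
  exact isDefectlessExtension_of_finrank_residue_adjoin_eq hle hp.pos hrelF hrr hdegr

end Prop412

end Literature.AlgebraicGeometry.Resolution
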